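import Mathlib
import Summits.CriticalPhenomena.PercolationContinuityZ3.Theorems.PercNearOneGluingNoHeavyLowerTailFatMinorityOnePortCertificate
import HarnessLib

/-!
# `NoHeavyLowerTail` (stmt-CriticalPhenomena-4575), line fat-minority-linear — the up-set star inequality FROM a
# one-port certificate (route task `nh-dp-fatminority`, gen 9; capstone of `…FatMinorityOnePortCertificate`)

Setting of `onePort_bracket` / `offPort_cells`: `μ = prodBernoulli w` on the pairs of `Fin n`, observer `o` isolated in
`G ∖ A`, up-set `𝒰 ⊆ 𝒫(A)` (`∅ ∉ 𝒰`) generating `U = {ω | ∃ B ∈ 𝒰, ∀ u ∈ B, s(o,u) ∈ ω}`, a port `a ∈ A`, `e = s(o,a)`,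
`U^a = {e open} ∩ U`, `μ₁ = μ_{w[e↦1]}`, `D = {c ↮ a}` (under `μ₁`: `c` not joined to the merged `o∪a`).

`upsetStar_of_onePortCertificate`: if the CERTIFICATE INEQUALITY at the port `a` holds —
  `μ₁(D) · Σ_{B∈𝒰, a∉B} (R'(c) − R'(v B))⁺ μ(σ_B) ≤ μ₁(D) · t · μ(U) + w(e) · μ₁(D ∩ U^a) · (μ₁(a↔b) − μ₁(c↔b))`
(the conjecture (C2∃) of FINDINGS-fat-minority-gen9 §5d says some port satisfies it with `t = (μ(c↔b) − min_{v∈A} μ(v↔b))⁺`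
whenever `μ₁'(c↔b) ≤ μ₁'(a'↔b)` at every port `a'`), and `μ₁(D) > 0`, then
  `μ({c↔b} ∩ U) − μ({o↔b} ∩ U) ≤ t · μ(U)`,
i.e. the target of the (UT4, QUT4) induction (PROOF-INDUCTION-modulo-C2.md).  Pure bookkeeping on top of the two proved
halves; no new definitions.
-/

namespace Summit.CriticalPhenomena.PercolationContinuityZ3.Theorems

open MeasureTheory Set
open Literature.Probability.LatticeModels (prodBernoulli)
open Literature.Probability.Percolation

noncomputable section
open scoped Classical

variable {n : ℕ}

/-- **The up-set star inequality from a one-port certificate.**  With the notation of the module docstring: if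
`0 < μ₁(D)` and
`μ₁(D) · Σ_{B ∈ 𝒰, a ∉ B} (R'(c) − R'(v B))⁺ μ(σ_B) ≤ μ₁(D) · t · μ(U) + w(e) · μ₁(D ∩ U^a) · (μ₁(a↔b) − μ₁(c↔b))`,
then `μ({c↔b} ∩ U) − μ({o↔b} ∩ U) ≤ t · μ(U)`.  Proof: split `U` along `a` (`real_inter_upEvent_split`), bound the
cells containing `a` by `onePort_bracket` and the cells avoiding `a` by `offPort_cells`, and add.
[cite: KozmaNitzan2024, Lemma 3 p. 6 and Lemma 5 p. 13; VandenbergHaggstromKahn2005, Thm. 1.5; combination: route notes gen 9] -/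
theorem upsetStar_of_onePortCertificate (w : Sym2 (Fin n) → unitInterval) (A : Finset (Fin n))
    (o a c b : Fin n) (hoA : o ∉ A) (haA : a ∈ A) (hco : c ≠ o)
    (hiso : ∀ u, u ≠ o → u ∉ A → w s(o, u) = 0)
    (𝒰 : Finset (Finset (Fin n))) (h𝒰A : 𝒰 ⊆ A.powerset)
    (hup : ∀ B ∈ 𝒰, ∀ B' ∈ A.powerset, B ⊆ B' → B' ∈ 𝒰)
    (v : Finset (Fin n) → Fin n) (hv : ∀ B ∈ 𝒰, a ∉ B → v B ∈ B) (t : ℝ)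
    (hD : 0 < (prodBernoulli (Function.update w s(o, a) 1)).real (openConn c a)ᶜ)
    (hcert :
      (prodBernoulli (Function.update w s(o, a) 1)).real (openConn c a)ᶜ *
          ∑ B ∈ 𝒰.filter (fun B => a ∉ B),
            max 0 ((prodBernoulli w).real (openConnIn ({o}ᶜ : Set (Fin n)) c b) -
                (prodBernoulli w).real (openConnIn ({o}ᶜ : Set (Fin n)) (v B) b)) *
              (prodBernoulli w).real (starEvent o (↑B : Set (Fin n))) ≤
        (prodBernoulli (Function.update w s(o, a) 1)).real (openConn c a)ᶜ * t *
            (prodBernoulli w).real {ω | ∃ B ∈ 𝒰, ∀ u ∈ B, s(o, u) ∈ ω} +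
          (w s(o, a) : ℝ) *
            (prodBernoulli (Function.update w s(o, a) 1)).real
              ((openConn c a)ᶜ ∩ ({ω | s(o, a) ∈ ω} ∩ {ω | ∃ B ∈ 𝒰, ∀ u ∈ B, s(o, u) ∈ ω})) *
            ((prodBernoulli (Function.update w s(o, a) 1)).real (openConn a b) -
              (prodBernoulli (Function.update w s(o, a) 1)).real (openConn c b))) :
    (prodBernoulli w).real (openConn c b ∩ {ω | ∃ B ∈ 𝒰, ∀ u ∈ B, s(o, u) ∈ ω}) -
        (prodBernoulli w).real (openConn o b ∩ {ω | ∃ B ∈ 𝒰, ∀ u ∈ B, s(o, u) ∈ ω}) ≤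
      t * (prodBernoulli w).real {ω | ∃ B ∈ 𝒰, ∀ u ∈ B, s(o, u) ∈ ω} := by
  set μ := prodBernoulli w with hμ
  set μ₁ := prodBernoulli (Function.update w s(o, a) 1) with hμ₁
  set U : Set (BondConfig (Fin n)) := {ω | ∃ B ∈ 𝒰, ∀ u ∈ B, s(o, u) ∈ ω} with hU
  set Ua : Set (BondConfig (Fin n)) := {ω | s(o, a) ∈ ω} ∩ U with hUa
  -- split along the port
  have hsc := real_inter_upEvent_split μ s(o, a) (openConn c b) U
  have hso := real_inter_upEvent_split μ s(o, a) (openConn o b) U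
  -- the two halves
  have hbr := onePort_bracket w A o a c b hoA haA 𝒰 h𝒰A
  have hoff := offPort_cells w A o a c b hoA haA hco hiso 𝒰 h𝒰A hup v hv
  -- abbreviations
  set Dm := μ₁.real (openConn c a)ᶜ with hDm
  set L := ∑ B ∈ 𝒰.filter (fun B => a ∉ B),
      max 0 (μ.real (openConnIn ({o}ᶜ : Set (Fin n)) c b) -
        μ.real (openConnIn ({o}ᶜ : Set (Fin n)) (v B) b)) * μ.real (starEvent o (↑B : Set (Fin n))) with hL
  set X := μ.real (openConn c b ∩ Ua) - μ.real (openConn o b ∩ Ua) with hX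
  set Y := μ.real (openConn c b ∩ U ∩ {ω | s(o, a) ∉ ω}) -
      μ.real (openConn o b ∩ U ∩ {ω | s(o, a) ∉ ω}) with hY
  set G := (w s(o, a) : ℝ) * μ₁.real ((openConn c a)ᶜ ∩ Ua) *
      (μ₁.real (openConn c b) - μ₁.real (openConn a b)) with hG
  -- hbr : Dm * X ≤ G ;  hoff : Y ≤ L ;  hcert : Dm * L ≤ Dm * t * μ(U) - G
  have h1 : Dm * X ≤ G := hbr
  have h2 : Y ≤ L := hoff
  have h3 : Dm * L ≤ Dm * t * μ.real U +
      (w s(o, a) : ℝ) * μ₁.real ((openConn c a)ᶜ ∩ Ua) *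
        (μ₁.real (openConn a b) - μ₁.real (openConn c b)) := hcert
  have hG' : (w s(o, a) : ℝ) * μ₁.real ((openConn c a)ᶜ ∩ Ua) *
        (μ₁.real (openConn a b) - μ₁.real (openConn c b)) = -G := by
    rw [hG]; ring
  rw [hG'] at h3
  have hsum : μ.real (openConn c b ∩ U) - μ.real (openConn o b ∩ U) = X + Y := by
    rw [hsc, hso, hX, hY]; ring
  rw [hsum]
  -- Dm * (X + Y) ≤ G + Dm * L ≤ Dm * t * μ(U)
  have h4 : Dm * (X + Y) ≤ Dm * t * μ.real U := by
    have hDm0 : 0 ≤ Dm := measureReal_nonneg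
    nlinarith [h1, h2, h3, mul_le_mul_of_nonneg_left h2 hDm0]
  have h5 : Dm * (X + Y) ≤ Dm * (t * μ.real U) := by linarith [h4]
  exact le_of_mul_le_mul_left h5 hD

end

end Summit.CriticalPhenomena.PercolationContinuityZ3.Theorems
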